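import Summits.QuantumFields.YangMills.Theorems.BalabanUVNodesN15ColouredLiveBackgroundMatrixObjects
import Summits.QuantumFields.YangMills.Theorems.BalabanUVNodesN15ColouredSiteObject
import Summits.QuantumFields.YangMills.Theorems.BalabanUVNodesN15GenuineSiteKernelRate
import HarnessLib

/-!
# N15 = NE2 — Σ-col (J-c): ★★★ THE SITE LAYER OF dag-n15-c's LIVE SMALL-FIELD FAMILY READS THE NON-ABELIAN POTENTIAL — `NE2PlusSite` BY NAME for the U-live site kernel
# `S(A′) = a·1 + Δ⊗1 + exDress a (Δ⊗1) Z(A′) = (Sym unitBondMatC((Q⊗1) X(A′) (Q*⊗1)))⁻¹` on `sfInstance`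
# (dag-n15-a g29, programme Σ-col, FILE (J-c); node N15 = NE2; `--supports stmt-QuantumFields-27366 --as helper`, count-neutral; one plumbing `def` + theorems)

WHY.  N15 [NE2] is booked AS CONSUMED at the U-blind v7 pin with rider «(+1 located burden: non-abelian `G(U)` dressing of NE2 ← N15 U-blind pin; typed home-to-be = n15-c road (c))»
(FLAG №13).  The road-(c) literal (Σ-F `sfObjects₄cov`) reads the matrix potential `A′` in the OPERATOR layer only; its SITE and UNIT layers are the genuine `U ≡ 1` kernels re-based
(Σ-E: U-blind on this carrier, said).  Σ-A made the site layer U-live for the ABELIANISED pair of record; this file does it for dag-n15-c's NON-ABELIAN family: the site object is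
Bałaban's `(Q G(U) Q*)⁻¹` ((1.102)–(1.103), [B9] (3.132)-type) at their live glued covariant propagator `X(A′) = cvGlued(e^{ηA′})`, colour by colour, symmetrised in the bond basis — in
position space (J-c′) `siteC M ι n a Z(A′) = a·1 + Δ^{(n)}⊗1 + exDress a (Δ^{(n)}⊗1) Z(A′)` with the live background matrix `Z(A′) = zLiveC∕zLiveF` of (J-b′) ((J-c′) `siteC_eq_inv_symPart`).

HOW.  (J-b′) `exists_zLive_letters` (the three letters of `Z`, `Z′`, `Z′ − Z` in FILE 133's regime) → (J-c′) `siteC_sub_letters` (King's (1.66) letter ⊗ colour + Σ-col (H) (iii)); the readout at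
unit sites (G1's pattern: the `(L^jη)^{−p}(L^{j′}η)^{−d′}` prefactors are `1`, the rate factor is `(L^k)^{−1∕16}`); the class `Reg335 c₃₅ α₀ A′` of `sfInstance` IS FILE 133's C²-window at scale
`r_A = c₃₅·L^m·α₀` (FILE 145's conversion, verbatim), the regime's `L^m ≥ w₀` IS `NE2PlusSite`'s size threshold `M₅ ≤ (gf i).M = L^m`, and its smallness of `r_A` (`2(2+d)(5+2d)r_A ≤ 1`,
`σκ_e r_A J ≤ R₀`, `K_Zκ_e r_A ≤ ζ₀`, `κ_e r_A ≤ 1`) IS the threshold `M·α₀ ≤ a₀`.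

WHAT.  §1 def `foSiteSf` (the U-live site kernel on `sfInstance`: fine `siteC` at `zLiveF(A′)` minus coarse `siteC` at `zLiveC(A′)`, read at the coloured unit bonds `((ȳ,α),j)`, `((ȳ′,β),j′)`),
`foSiteSf_ker`, ★ `foSiteSf_one` (at the carrier's `one` the kernel IS King's (1.66) η-difference ⊗ 1_ι — the live and the U-blind site objects AGREE at `U ≡ 1`), ★★ `siteC_zLiveC_eq_inv_symPart` ∕
`siteC_zLiveF_eq_inv_symPart` (THE HONEST DICTIONARY AT THE FAMILY: both site objects ARE `(Sym unitBondMatC((Q⊗1) G(U(A′)) (Q*⊗1)))⁻¹` at dag-n15-c's LIVE glued covariant propagators — EXACT inverses).  §2 ★★★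
**`ne2PlusSite_foSiteSf`**: odd `L ≥ 7`, `a, c₃₅ > 0`, trace-form-orthonormal `e`, `ι` nonempty ⟹ `NE2PlusSite d′ p c₃₅ (sfInstance d mm ι hL) (foSiteSf d mm ι a e hL α β j j′)` for all
`α β j j′ d′ p` — the SITE LAYER of dag-n15-c's family with the background LIVE.  (The knit with Σ-F's operator layer is the sequel, FILE (J-d).)

HONEST FRAMING ∕ LIMITS.  MODEL objects exactly as dag-n15-c FILE 130∕133 (global small-field gauge; covariant Laplacian ⊗ colour + FLAT nonlocal part; King-block-mean pairing; doubled torus;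
`L ≥ 7`) — NOT [B9] Thm 3.2 ∕ (3.132) AS PRINTED; the UNIT layer on this carrier stays U-blind (needs b06's bond elimination ⊗ colour — not in the tree, said).  N15 stays DISCHARGED OF RECORD
AS CONSUMED (U-blind v7 pin, p687738) — nothing re-claimed, no re-pin asked, no count moved (typed 28∕28 · discharged 8∕28); K3⁸ OPEN; one finite 𝕋⁴ at fixed ε per index — NOT ℝ⁴ ∕ infinite
volume ∕ OS ∕ mass gap ∕ Clay.  One plumbing `def` ⇒ review ∕ audit lane.  No `sorry`, `instance`, `notation`; standard axioms.
-/

noncomputable section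

open scoped BigOperators Matrix Matrix.Norms.Frobenius Kronecker

namespace Summit.QuantumFields.YangMills.BalabanUVNodes.N15.SiteLayerSf

open Literature.MathematicalPhysics.QuantumFieldTheory.Balaban1983to89
open Literature.MathematicalPhysics.QuantumFieldTheory.King1986 (exp_decay_mono)
open Literature.MathematicalPhysics.QuantumFieldTheory.Balaban1983to89.T4EtaRate (PairedInstance NE2PlusSite EtaRateIneqSite rateFactor)
open Literature.MathematicalPhysics.QuantumFieldTheory.Balaban1983to89.T4EtaRateDefect (rateWeight)
open Literature.MathematicalPhysics.QuantumFieldTheory.Balaban1983to89.B5Prop11Plancherel (Tor fine)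
open Literature.MathematicalPhysics.QuantumFieldTheory.Balaban1983to89.B6Lemma24Torus (pbox)
open Literature.MathematicalPhysics.QuantumFieldTheory.Balaban1983to89.B6BondEliminationTorus (pdist)
open Literature.MathematicalPhysics.QuantumFieldTheory.Balaban1983to89.B6Cov2156Torus (deltaPol one_le_M)
open Literature.MathematicalPhysics.QuantumFieldTheory.Balaban1983to89.B6LowerBound2153Torus (rep rep_mem_pbox)
open Literature.MathematicalPhysics.QuantumFieldTheory.Balaban1983to89.B6UnitTorusCarrier (unitTorusGeo pdist_rep_rep)
open Literature.MathematicalPhysics.QuantumFieldTheory.King1986.Torus (tdistT tdistT_nonneg)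
open Literature.Barriers.QuantumFields (traceForm)
open Summit.QuantumFields.YangMills.BalabanUVNodes.N15.OperatorReadout (opGeo)
open Summit.QuantumFields.YangMills.BalabanUVNodes.N15.GenuineSite (etaRateIneqSite_opGeo_unit)
open Summit.QuantumFields.YangMills.BalabanUVNodes.N15.VectorPiece (bshiftEquiv kingPrV tensorId unitTorusGeoS rateWeight_unitTorusGeoS)
open Summit.QuantumFields.YangMills.BalabanUVNodes.N15.MatrixSpecies (basisConst basisConst_nonneg liftBlk)
open Summit.QuantumFields.YangMills.BalabanUVNodes.N15.UnitLayerBgCol (cdist cdist_eq cdist_nonneg kron_one_sub_apply siteC siteC_apply siteC_zero siteC_sub_letters siteC_eq_inv_symPart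
  unitBondMatC)
open Summit.QuantumFields.YangMills.BalabanUVNodes.N15.UnitLayerBg (symPart)
open Summit.QuantumFields.YangMills.BalabanUVNodes.N15.BackgroundLayer (gavgM)
open Summit.QuantumFields.YangMills.BalabanUVNodes.N15.TwoGrid (gOp qvRe qvAdjRe)
open Summit.QuantumFields.YangMills.BalabanUVNodes.N15.Gluing (SfIdx sfGeo sfInstance sfInstance_reg335_iff sfInstance_gf_M CvX CvX' cvM cvBlk cvNL cvNL' cvGlued cvGlued')
open Summit.QuantumFields.YangMills.BalabanUVNodes.N15.GluedZeroField (zLiveC zLiveF exists_zLive_letters exists_zLive_zero)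

variable (d : ℕ) {L : ℕ} [NeZero L] (mm ι : Type) [Fintype mm] [DecidableEq mm] [Fintype ι] [DecidableEq ι] (a : ℝ) (e : Matrix mm mm ℂ ≃L[ℝ] (ι → ℝ))

/-! ## §1 The U-live site kernel on dag-n15-c's family -/

section Kernel

/-- ★ **THE U-LIVE SITE-LAYER η-DIFFERENCE KERNEL ON dag-n15-c's SMALL-FIELD FAMILY**: on `sfInstance d mm ι hL i`, `(A′, y, y′) ↦ S′(A′)(((ȳ,α),j),((ȳ′,β),j′)) − S(A′)(…)` — the fine
run's site object `siteC (L^rL^k) a (zLiveF … A′)` minus the coarse run's `siteC (L^k) a (zLiveC … A′)` (coarse partner = the block-mean field, inside `zLiveC`), read at the coloured unit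
bonds of directions `α, β` and colours `j, j′` based at the box representatives. [cite: Balaban1985BackgroundPropagators, (3.132) p.422 (object `(QG(U)Q*)⁻¹`, shape); Balaban1984PropagatorsI, (1.102)–(1.103) p.34] -/
def foSiteSf (hL : Odd L ∧ 1 < L) (α β : Fin (d + 1)) (j j' : ι) (i : SfIdx d L) : B9.SiteKernel (sfInstance d mm ι hL i).gc (sfInstance d mm ι hL i).Bf :=
  ⟨fun A' y y' =>
    siteC (cvM d L i.m i.kk hL) ι (L ^ i.r * L ^ i.kk) a (zLiveF d mm ι a e hL i.m i.kk i.r A')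
        ((⟨rep (cvM d L i.m i.kk hL) y, rep_mem_pbox (cvM d L i.m i.kk hL) y⟩, α), j) ((⟨rep (cvM d L i.m i.kk hL) y', rep_mem_pbox (cvM d L i.m i.kk hL) y'⟩, β), j')
      - siteC (cvM d L i.m i.kk hL) ι (L ^ i.kk) a (zLiveC d mm ι a e hL i.m i.kk i.r A')
        ((⟨rep (cvM d L i.m i.kk hL) y, rep_mem_pbox (cvM d L i.m i.kk hL) y⟩, α), j) ((⟨rep (cvM d L i.m i.kk hL) y', rep_mem_pbox (cvM d L i.m i.kk hL) y'⟩, β), j')⟩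

/-- Unfolding of `foSiteSf`. [folklore] -/
theorem foSiteSf_ker (hL : Odd L ∧ 1 < L) (α β : Fin (d + 1)) (j j' : ι) (i : SfIdx d L) (A' : Fin (d + 1) → CvX' d L i.m i.kk i.r hL → Matrix mm mm ℂ)
    (y y' : Tor (cvM d L i.m i.kk hL)) :
    (foSiteSf d mm ι a e hL α β j j' i).ker A' y y' =
      siteC (cvM d L i.m i.kk hL) ι (L ^ i.r * L ^ i.kk) a (zLiveF d mm ι a e hL i.m i.kk i.r A')
          ((⟨rep (cvM d L i.m i.kk hL) y, rep_mem_pbox (cvM d L i.m i.kk hL) y⟩, α), j) ((⟨rep (cvM d L i.m i.kk hL) y', rep_mem_pbox (cvM d L i.m i.kk hL) y'⟩, β), j')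
        - siteC (cvM d L i.m i.kk hL) ι (L ^ i.kk) a (zLiveC d mm ι a e hL i.m i.kk i.r A')
          ((⟨rep (cvM d L i.m i.kk hL) y, rep_mem_pbox (cvM d L i.m i.kk hL) y⟩, α), j) ((⟨rep (cvM d L i.m i.kk hL) y', rep_mem_pbox (cvM d L i.m i.kk hL) y'⟩, β), j') := rfl

/-- ★ **AT THE ZERO POTENTIAL THE U-LIVE SITE KERNEL IS KING's (1.66) η-DIFFERENCE ⊗ 1_ι** (`L ≥ 7` odd, `a > 0`, indices with `L^m ≥ w₀`, trace-form-orthonormal `e`): at the carrier's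
`one` (the zero potential) both live background matrices vanish ((J-b′) `exists_zLive_zero`), both dressings vanish, the `a·1` cancel — the kernel is `(Δ^{(L^rL^k)} − Δ^{(L^k)}) ⊗ₖ 1` at
the bonds: the live and the U-blind site objects AGREE at `U ≡ 1`. [cite: Balaban1984PropagatorsI, (1.66) p.29, (1.71) p.30; King1986, Lemma 4.5 (4.38) p.674 (shape)] -/
theorem foSiteSf_one (hL : Odd L ∧ 1 < L) (hL7 : 7 ≤ L) (ha : 0 < a) (α β : Fin (d + 1)) (j j' : ι) :
    ∃ w₀ : ℝ, ∀ (i : SfIdx d L), w₀ ≤ ((L ^ i.m : ℕ) : ℝ) → (∀ A B : Matrix mm mm ℂ, traceForm A B = e A ⬝ᵥ e B) → ∀ (y y' : Tor (cvM d L i.m i.kk hL)),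
      (foSiteSf d mm ι a e hL α β j j' i).ker (sfInstance d mm ι hL i).Bf.one y y' =
        ((deltaPol (cvM d L i.m i.kk hL) (L ^ i.r * L ^ i.kk) - deltaPol (cvM d L i.m i.kk hL) (L ^ i.kk)) ⊗ₖ (1 : Matrix ι ι ℝ))
          ((⟨rep (cvM d L i.m i.kk hL) y, rep_mem_pbox (cvM d L i.m i.kk hL) y⟩, α), j) ((⟨rep (cvM d L i.m i.kk hL) y', rep_mem_pbox (cvM d L i.m i.kk hL) y'⟩, β), j') := by
  obtain ⟨w₀, H⟩ := exists_zLive_zero d mm ι a e hL hL7 ha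
  refine ⟨w₀, fun i hw he y y' => ?_⟩
  have hLpos : 0 < L := Nat.pos_of_ne_zero (NeZero.ne L)
  have hLk : 1 ≤ L ^ i.kk := Nat.one_le_pow _ _ hLpos
  have hLrk : 1 ≤ L ^ i.r * L ^ i.kk := Nat.one_le_iff_ne_zero.mpr (Nat.mul_ne_zero (pow_ne_zero _ hLpos.ne') (pow_ne_zero _ hLpos.ne'))
  obtain ⟨hZc, hZf⟩ := H i.m i.kk i.r i.one_le hw he
  have h1 : (sfInstance d mm ι hL i).Bf.one = (0 : Fin (d + 1) → CvX' d L i.m i.kk i.r hL → Matrix mm mm ℂ) := rfl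
  haveI : NeZero (L ^ i.kk) := ⟨by omega⟩
  haveI : NeZero (L ^ i.r * L ^ i.kk) := ⟨by omega⟩
  rw [h1, foSiteSf_ker, hZc, hZf, siteC_zero _ _ _ _ hLrk ha, siteC_zero _ _ _ _ hLk ha, Matrix.add_apply, Matrix.add_apply, ← kron_one_sub_apply]
  ring

set_option maxRecDepth 8192 in
/-- ★★ **THE HONEST DICTIONARY AT THE FAMILY, COARSE RUN: `S(A′) = (Sym unitBondMatC((Q⊗1) G_k(U(A′)) (Q*⊗1)))⁻¹`** — the coarse site object of `foSiteSf` IS the (symmetrised) INVERSE of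
dag-n15-c's glued covariant propagator of the block-mean bond field (FILE 127 `cvGlued`, transports `e^{ηĀ′}`) sandwiched by Bałaban's `Q ⊗ 1`, `Q* ⊗ 1` — (1.102)–(1.103)'s `E ↦ (QEQ*)⁻¹`
at the LIVE propagator, colour by colour; no Neumann series.  ((J-c′) `siteC_eq_inv_symPart` at `X = cvGlued …`; the one-time unfolding of (J-b′) `zLiveC` is a deep structural comparison.)
MODEL: flat nonlocal part (1.69), King-block-mean pairing — NOT [B9] (3.132) as printed. [cite: Balaban1984PropagatorsI, (1.102)–(1.103) p.34; Balaban1985BackgroundPropagators, (3.132) p.422 (object, shape)] -/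
theorem siteC_zLiveC_eq_inv_symPart (hL : Odd L ∧ 1 < L) (ha : 0 < a) (m kk r : ℕ) (A' : Fin (d + 1) → CvX' d L m kk r hL → Matrix mm mm ℂ) :
    siteC (cvM d L m kk hL) ι (L ^ kk) a (zLiveC d mm ι a e hL m kk r A') =
      (symPart (unitBondMatC (cvM d L m kk hL) ι (tensorId ι (qvRe (cvM d L m kk hL) (L ^ kk)) ∘ₗ
          cvGlued d L m kk hL a ((((L ^ kk : ℕ) : ℝ))⁻¹) ι e (fun _ _ => (1 : Matrix mm mm ℂ))
              (fun μ x => NormedSpace.exp (((((L ^ kk : ℕ) : ℝ))⁻¹) • gavgM (Matrix mm mm ℂ) (Fin (d + 1)) (kingPrV L kk r (cvM d L m kk hL)) A' μ x)) (cvNL d L m kk hL a ι)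
              (fun _ => 0) ∘ₗ
            tensorId ι (qvAdjRe (cvM d L m kk hL) (L ^ kk)))))⁻¹ := by
  have hLk : 1 ≤ L ^ kk := Nat.one_le_pow _ _ (Nat.pos_of_ne_zero (NeZero.ne L))
  unfold zLiveC
  exact siteC_eq_inv_symPart _ _ _ _ hLk ha _

set_option maxRecDepth 8192 in
/-- ★★ **THE HONEST DICTIONARY AT THE FAMILY, FINE RUN: `S′(A′) = (Sym unitBondMatC((Q′⊗1) G_{k+r}(U(A′)) (Q′*⊗1)))⁻¹`** (FILE 128 `cvGlued′`, transports `e^{η′A′}`). [cite: Balaban1984PropagatorsI, (1.102)–(1.103) p.34; Balaban1985BackgroundPropagators, (3.132) p.422 (object, shape)] -/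
theorem siteC_zLiveF_eq_inv_symPart (hL : Odd L ∧ 1 < L) (ha : 0 < a) (m kk r : ℕ) (A' : Fin (d + 1) → CvX' d L m kk r hL → Matrix mm mm ℂ) :
    siteC (cvM d L m kk hL) ι (L ^ r * L ^ kk) a (zLiveF d mm ι a e hL m kk r A') =
      (symPart (unitBondMatC (cvM d L m kk hL) ι (tensorId ι (qvRe (cvM d L m kk hL) (L ^ r * L ^ kk)) ∘ₗ
          cvGlued' d L m kk r hL a ((((L ^ r * L ^ kk : ℕ) : ℝ))⁻¹) ι e (fun _ _ => (1 : Matrix mm mm ℂ)) (fun μ x' => NormedSpace.exp (((((L ^ r * L ^ kk : ℕ) : ℝ))⁻¹) • A' μ x'))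
              (cvNL' d L m kk r hL a ι) (fun _ => 0) ∘ₗ
            tensorId ι (qvAdjRe (cvM d L m kk hL) (L ^ r * L ^ kk)))))⁻¹ := by
  have hL0 : 0 < L := Nat.pos_of_ne_zero (NeZero.ne L)
  have hLrk : 1 ≤ L ^ r * L ^ kk := Nat.one_le_iff_ne_zero.mpr (Nat.mul_ne_zero (pow_ne_zero _ hL0.ne') (pow_ne_zero _ hL0.ne'))
  unfold zLiveF
  exact siteC_eq_inv_symPart _ _ _ _ hLrk ha _

end Kernel

/-! ## §2 ★★★ `NE2PlusSite` by name for the U-live site kernel on dag-n15-c's family -/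

section SiteLayer

set_option maxHeartbeats 800000 in
/-- ★★★ **`NE2PlusSite` — THE NODE's SECOND CONJUNCT BY NAME — FOR THE U-LIVE SITE KERNEL ON dag-n15-c's LIVE SMALL-FIELD FAMILY.**  For odd `L ≥ 7`, `a > 0`, `c₃₅ > 0`, a
trace-form-orthonormal coordinate system `e` of `M_N(ℂ) ≅ ℝ^ι` (`ι` nonempty), every direction pair `α β`, colour pair `j j′` and exponent pair `(d′, p)`:
`NE2PlusSite d′ p c₃₅ (sfInstance d mm ι hL) (foSiteSf d mm ι a e hL α β j j′)` — constants `(M₅, δ, a₀, C, γ) = (max(w₀,1), δ_S, a₀(e), C_S(2K_Z + 1) + 1, 1∕16)`.  The kernel READS the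
non-abelian potential `A′` (both background matrices live); the size threshold `M₅ ≤ L^m` IS FILE 133's `L^m ≥ w₀`; the guard `L^m·α₀ ≤ a₀` carries FILE 133's smallness of `r_A = c₃₅L^mα₀`
(incl. (H)'s finite Combes–Thomas margin `K_Zκ_e r_A ≤ ζ₀`); mechanism (J-c′) `siteC_sub_letters`: `|S′ − S| ≤ C_S(τ + (L^k)⁻¹)e^{−δ_Sρ}`, `τ = K_Z((L^k)^{−1∕16} + κ_e r_A L^{−k})`; at unit sites
the `(L^jη)^{−p}(L^{j′}η)^{−d′}` prefactors are `1` and the rate factor is `(L^k)^{−1∕16}`.  MODEL objects as FILE 133∕145 — NOT [B9] Thm 3.2∕(3.132) as printed.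
[cite: Balaban1985BackgroundPropagators, Thm 3.2 (3.48) p.398 + (3.132) p.422 + Thm 3.14 pp.426–427 (quantifier template, shapes), (3.35) p.396; Balaban1984PropagatorsI, (1.66) p.29, (1.102)–(1.103) p.34; King1986, Lemma 4.5 (4.38)–(4.41) pp.674–675 (mechanism); CombesThomas1973, §II (mechanism)] -/
theorem ne2PlusSite_foSiteSf [Nonempty ι] (hL : Odd L ∧ 1 < L) (hL7 : 7 ≤ L) (ha : 0 < a) {c35 : ℝ} (hc35 : 0 < c35)
    (he : ∀ A B : Matrix mm mm ℂ, traceForm A B = e A ⬝ᵥ e B) (α β : Fin (d + 1)) (j j' : ι) (d' : ℕ) (p : ℝ) :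
    NE2PlusSite d' p c35 (sfInstance d mm ι hL) (foSiteSf d mm ι a e hL α β j j') := by
  have hLpos : 0 < L := Nat.pos_of_ne_zero (NeZero.ne L)
  have hLr : (0 : ℝ) < (L : ℝ) := Nat.cast_pos.mpr hLpos
  have hL1 : (1 : ℝ) ≤ (L : ℝ) := by exact_mod_cast hLpos
  -- the two constant packages
  obtain ⟨δz, w₀, R₀, Kz, hδz, hR₀, hKz, HZ⟩ := exists_zLive_letters d mm ι a e hL hL7 ha
  obtain ⟨C, δS, ζ₀, hC, hδS, hζ₀, HS⟩ := siteC_sub_letters d (Fintype.card ι) ha hδz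
  -- the thresholds (FILE 145's `σ, JJ, W, a_W, a_R` + the margins `a_ζ`, `a_1`)
  have hκ0 : 0 ≤ basisConst e := basisConst_nonneg e
  let σ : ℝ := 14 * Real.exp 1 * (1 + Fintype.card (Fin (d + 1))) * basisConst e * ((1 + Fintype.card (Fin (d + 1))) * (3 + 2 * ((d : ℝ) + 1)))
  have hσ0 : 0 ≤ σ := by positivity
  let JJ : ℝ := 1 + Fintype.card (Fin (d + 1) ⊕ Fin (d + 1))
  have hJJ0 : 0 ≤ JJ := by positivity
  let W : ℝ := 2 * ((1 + Fintype.card (Fin (d + 1))) * (3 + 2 * ((d : ℝ) + 1)))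
  have hW0 : 0 < W := by positivity
  let aW : ℝ := 1 / (W * c35)
  have haW : 0 < aW := by positivity
  let aR : ℝ := R₀ / (σ * c35 * JJ + 1)
  have haR : 0 < aR := by positivity
  let aζ : ℝ := ζ₀ / (Kz * (basisConst e + 1) * c35)
  have haζ : 0 < aζ := by positivity
  let a1 : ℝ := 1 / ((basisConst e + 1) * c35)
  have ha1 : 0 < a1 := by positivity
  let a₀ : ℝ := min (min aW aR) (min aζ a1)
  have ha₀ : 0 < a₀ := lt_min (lt_min haW haR) (lt_min haζ ha1)
  have ha₀W : a₀ ≤ aW := (min_le_left _ _).trans (min_le_left _ _)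
  have ha₀R : a₀ ≤ aR := (min_le_left _ _).trans (min_le_right _ _)
  have ha₀ζ : a₀ ≤ aζ := (min_le_right _ _).trans (min_le_left _ _)
  have ha₀1 : a₀ ≤ a1 := (min_le_right _ _).trans (min_le_right _ _)
  let M₁ : ℝ := max w₀ 1
  have hM₁ : 0 < M₁ := lt_of_lt_of_le one_pos (le_max_right _ _)
  refine ⟨M₁, δS, a₀, C * (2 * Kz + 1) + 1, 1 / 16, hM₁, hδS, ha₀, by positivity, by norm_num, fun i hM α₀ hα₀ hMa A' hA' => ?_⟩
  -- the index's scalar facts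
  rw [sfInstance_gf_M] at hM hMa
  have hw₀ : w₀ ≤ ((L ^ i.m : ℕ) : ℝ) := by push_cast; exact (le_max_left _ _).trans hM
  have hx1 : (1 : ℝ) ≤ (L : ℝ) ^ i.kk := one_le_pow₀ hL1
  have hxpos : (0 : ℝ) < (L : ℝ) ^ i.kk := pow_pos hLr _
  have hcast : (((L ^ i.kk : ℕ) : ℝ)) = (L : ℝ) ^ i.kk := by push_cast; rfl
  have hLk : 1 ≤ L ^ i.kk := Nat.one_le_pow _ _ hLpos
  have hLrr : 1 ≤ L ^ i.r := Nat.one_le_pow _ _ hLpos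
  set t : ℝ := ((L : ℝ) ^ i.kk) ^ (-(1 / 16 : ℝ)) with ht_def
  have ht0 : 0 ≤ t := Real.rpow_nonneg hxpos.le _
  have hθt : (((L ^ i.kk : ℕ) : ℝ)) ^ (-(1 / 16 : ℝ)) = t := by rw [hcast]
  have hinv : ((((L ^ i.kk : ℕ) : ℝ)))⁻¹ ≤ t := by
    rw [hcast, ← Real.rpow_neg_one]; exact Real.rpow_le_rpow_of_exponent_le hx1 (by norm_num)
  have hη0 : 0 ≤ ((((L ^ i.kk : ℕ) : ℝ)))⁻¹ := by positivity
  -- the class at the index: skewness and the C² window at scale `r_A = c₃₅L^mα₀` (FILE 145's conversion)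
  obtain ⟨hskew, h1, h2, h3⟩ := (sfInstance_reg335_iff d mm ι hL i c35 α₀ A').1 hA'
  have hconv : ((L : ℝ) ^ i.kk)⁻¹ * ((L : ℝ) ^ i.r)⁻¹ = (((L ^ i.r * L ^ i.kk : ℕ) : ℝ))⁻¹ := by
    push_cast
    rw [mul_inv, mul_comm]
  have hrA0 : 0 ≤ c35 * (L : ℝ) ^ i.m * α₀ := by positivity
  have hrAa : c35 * (L : ℝ) ^ i.m * α₀ ≤ c35 * a₀ := by
    rw [mul_assoc]; exact mul_le_mul_of_nonneg_left hMa hc35.le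
  have h2' : ∀ μ κ x', ‖A' μ (bshiftEquiv (cvM d L i.m i.kk hL) (L ^ i.r * L ^ i.kk) κ x') - A' μ x'‖ ≤ c35 * (L : ℝ) ^ i.m * α₀ * ((((L ^ i.r * L ^ i.kk : ℕ) : ℝ))⁻¹) :=
    fun μ κ x' => (h2 μ κ x').trans_eq (by rw [hconv])
  have h3' : ∀ μ κ x', ‖(A' μ (bshiftEquiv (cvM d L i.m i.kk hL) (L ^ i.r * L ^ i.kk) κ x') - A' μ x') -
      (A' μ (bshiftEquiv (cvM d L i.m i.kk hL) (L ^ i.r * L ^ i.kk) κ ((bshiftEquiv (cvM d L i.m i.kk hL) (L ^ i.r * L ^ i.kk) μ).symm x')) -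
        A' μ ((bshiftEquiv (cvM d L i.m i.kk hL) (L ^ i.r * L ^ i.kk) μ).symm x'))‖ ≤
      c35 * (L : ℝ) ^ i.m * α₀ * ((((L ^ i.r * L ^ i.kk : ℕ) : ℝ))⁻¹) * ((((L ^ i.r * L ^ i.kk : ℕ) : ℝ))⁻¹) :=
    fun μ κ x' => (h3 μ κ x').trans_eq (by rw [hconv])
  have hr2 : 2 * ((1 + Fintype.card (Fin (d + 1))) * ((3 + 2 * ((d : ℝ) + 1)) * (c35 * (L : ℝ) ^ i.m * α₀))) ≤ 1 := by
    have hWa : W * (c35 * a₀) ≤ 1 := by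
      calc W * (c35 * a₀) ≤ W * (c35 * aW) := mul_le_mul_of_nonneg_left (mul_le_mul_of_nonneg_left ha₀W hc35.le) hW0.le
        _ = 1 := by
          show W * (c35 * (1 / (W * c35))) = 1
          field_simp
    calc 2 * ((1 + Fintype.card (Fin (d + 1))) * ((3 + 2 * ((d : ℝ) + 1)) * (c35 * (L : ℝ) ^ i.m * α₀))) = W * (c35 * (L : ℝ) ^ i.m * α₀) := by ring
      _ ≤ W * (c35 * a₀) := mul_le_mul_of_nonneg_left hrAa hW0.le
      _ ≤ 1 := hWa
  have hscale : 14 * Real.exp 1 * (1 + Fintype.card (Fin (d + 1))) * basisConst e * ((1 + Fintype.card (Fin (d + 1))) * ((3 + 2 * ((d : ℝ) + 1)) * (c35 * (L : ℝ) ^ i.m * α₀))) =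
      σ * (c35 * (L : ℝ) ^ i.m * α₀) := by ring
  have hSle : σ * (c35 * (L : ℝ) ^ i.m * α₀) ≤ σ * (c35 * a₀) := mul_le_mul_of_nonneg_left hrAa hσ0
  have hRle : 14 * Real.exp 1 * (1 + Fintype.card (Fin (d + 1))) * basisConst e * ((1 + Fintype.card (Fin (d + 1))) * ((3 + 2 * ((d : ℝ) + 1)) * (c35 * (L : ℝ) ^ i.m * α₀))) *
      (1 + Fintype.card (Fin (d + 1) ⊕ Fin (d + 1))) ≤ R₀ := by
    rw [hscale]
    have hRa : σ * (c35 * aR) * JJ ≤ R₀ := by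
      have hden : 0 < σ * c35 * JJ + 1 := by positivity
      calc σ * (c35 * aR) * JJ = R₀ * (σ * c35 * JJ) / (σ * c35 * JJ + 1) := by
            show σ * (c35 * (R₀ / (σ * c35 * JJ + 1))) * JJ = R₀ * (σ * c35 * JJ) / (σ * c35 * JJ + 1)
            field_simp
        _ ≤ R₀ * (σ * c35 * JJ + 1) / (σ * c35 * JJ + 1) := by gcongr; linarith
        _ = R₀ := by field_simp
    calc σ * (c35 * (L : ℝ) ^ i.m * α₀) * JJ ≤ σ * (c35 * a₀) * JJ := mul_le_mul_of_nonneg_right hSle hJJ0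
      _ ≤ σ * (c35 * aR) * JJ := mul_le_mul_of_nonneg_right (mul_le_mul_of_nonneg_left (mul_le_mul_of_nonneg_left ha₀R hc35.le) hσ0) hJJ0
      _ ≤ R₀ := hRa
  -- the two margins: `κ_e r_A ≤ 1`, `K_Z κ_e r_A ≤ ζ₀`
  have hκr1 : basisConst e * (c35 * (L : ℝ) ^ i.m * α₀) ≤ 1 := by
    calc basisConst e * (c35 * (L : ℝ) ^ i.m * α₀) ≤ (basisConst e + 1) * (c35 * a1) :=
          mul_le_mul (by linarith) (hrAa.trans (mul_le_mul_of_nonneg_left ha₀1 hc35.le)) hrA0 (by positivity)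
      _ = 1 := by
          show (basisConst e + 1) * (c35 * (1 / ((basisConst e + 1) * c35))) = 1
          field_simp
  have hζle : Kz * basisConst e * (c35 * (L : ℝ) ^ i.m * α₀) ≤ ζ₀ := by
    calc Kz * basisConst e * (c35 * (L : ℝ) ^ i.m * α₀) ≤ Kz * (basisConst e + 1) * (c35 * aζ) :=
          mul_le_mul (mul_le_mul_of_nonneg_left (by linarith) hKz.le) (hrAa.trans (mul_le_mul_of_nonneg_left ha₀ζ hc35.le)) hrA0 (by positivity)
      _ = ζ₀ := by
          show Kz * (basisConst e + 1) * (c35 * (ζ₀ / (Kz * (basisConst e + 1) * c35))) = ζ₀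
          field_simp
  have hζ0 : 0 ≤ Kz * basisConst e * (c35 * (L : ℝ) ^ i.m * α₀) := by positivity
  have hτ0 : 0 ≤ Kz * ((((L ^ i.kk : ℕ) : ℝ)) ^ (-(1 / 16 : ℝ)) + basisConst e * (c35 * (L : ℝ) ^ i.m * α₀) * ((((L ^ i.kk : ℕ) : ℝ))⁻¹)) := by positivity
  -- (J-b′): the three letters of the live background matrices at this index and potential
  obtain ⟨hZ, hZ', hZZ⟩ := HZ i.m i.kk i.r i.one_le hw₀ he A' hskew (c35 * (L : ℝ) ^ i.m * α₀) hrA0 h1 h2' h3' hr2 hRle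
  -- (J-c′): the η-difference letter of the site objects
  have HSi := HS (cvM d L i.m i.kk hL) ι le_rfl (L ^ i.kk) (L ^ i.r * L ^ i.kk) (L ^ i.r) hLk hLrr rfl
    (zLiveC d mm ι a e hL i.m i.kk i.r A') (zLiveF d mm ι a e hL i.m i.kk i.r A') _ _ hζ0 hζle hτ0 hZ hZ' hZZ
  -- the readout at unit sites (G1 `etaRateIneqSite_opGeo_unit`: unit scale lengths, rate factor = rate weight `(L^k)^{−1/16}`)
  have hη : (sfGeo d hL i).eta ≠ 0 := by
    show ((L : ℝ) ^ i.kk)⁻¹ ≠ 0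
    exact inv_ne_zero (pow_ne_zero _ hLr.ne')
  have hlen : ∀ y : (sfGeo d hL i).Site, (sfGeo d hL i).len y = 1 := fun y => by
    show (L : ℝ) ^ i.kk * ((L : ℝ) ^ i.kk)⁻¹ = 1
    exact mul_inv_cancel₀ (pow_ne_zero _ hLr.ne')
  refine etaRateIneqSite_opGeo_unit (g := sfGeo d hL i) (X := CvX d L i.m i.kk hL × ι) (blk := liftBlk (cvBlk d L i.m i.kk hL) ι)
    (foSiteSf d mm ι a e hL α β j j' i) hlen hη hLr (fun y y' => ?_) d' p
  rw [rateWeight_unitTorusGeoS, rateWeight_unitTorusGeoS, max_self, foSiteSf_ker,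
    show (sfGeo d hL i).dist y y' = tdistT (cvM d L i.m i.kk hL) y y' from rfl]
  set M := cvM d L i.m i.kk hL with hMdef
  -- the coloured bonds read and their distance
  set pp : B4.Idx (pbox M) (d + 1) × ι := ((⟨rep M y, rep_mem_pbox M y⟩, α), j) with hpp
  set qq : B4.Idx (pbox M) (d + 1) × ι := ((⟨rep M y', rep_mem_pbox M y'⟩, β), j') with hqq
  have hcd : cdist M ι pp qq = tdistT M y y' := by
    rw [cdist_eq, hpp, hqq]
    exact pdist_rep_rep M (one_le_M M) y y'
  have hS := HSi pp qq
  rw [hcd] at hS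
  have hE := Real.exp_nonneg (-(δS * tdistT M y y'))
  -- the amplitude against `t = (L^k)^{−1∕16}`
  have hamp : C * (Kz * ((((L ^ i.kk : ℕ) : ℝ)) ^ (-(1 / 16 : ℝ)) + basisConst e * (c35 * (L : ℝ) ^ i.m * α₀) * ((((L ^ i.kk : ℕ) : ℝ))⁻¹)) + ((L ^ i.kk : ℕ) : ℝ)⁻¹)
      ≤ (C * (2 * Kz + 1) + 1) * t := by
    rw [hθt]
    have h2 : basisConst e * (c35 * (L : ℝ) ^ i.m * α₀) * ((((L ^ i.kk : ℕ) : ℝ))⁻¹) ≤ t := by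
      calc basisConst e * (c35 * (L : ℝ) ^ i.m * α₀) * ((((L ^ i.kk : ℕ) : ℝ))⁻¹) ≤ 1 * t := mul_le_mul hκr1 hinv hη0 zero_le_one
        _ = t := one_mul t
    have h4 : Kz * (t + basisConst e * (c35 * (L : ℝ) ^ i.m * α₀) * ((((L ^ i.kk : ℕ) : ℝ))⁻¹)) ≤ Kz * (t + t) :=
      mul_le_mul_of_nonneg_left (add_le_add le_rfl h2) hKz.le
    calc C * (Kz * (t + basisConst e * (c35 * (L : ℝ) ^ i.m * α₀) * ((((L ^ i.kk : ℕ) : ℝ))⁻¹)) + ((L ^ i.kk : ℕ) : ℝ)⁻¹) ≤ C * (Kz * (t + t) + t) :=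
          mul_le_mul_of_nonneg_left (add_le_add h4 hinv) hC.le
      _ = (C * (2 * Kz + 1)) * t := by ring
      _ ≤ (C * (2 * Kz + 1) + 1) * t := mul_le_mul_of_nonneg_right (by linarith) ht0
  calc _ ≤ C * (Kz * ((((L ^ i.kk : ℕ) : ℝ)) ^ (-(1 / 16 : ℝ)) + basisConst e * (c35 * (L : ℝ) ^ i.m * α₀) * ((((L ^ i.kk : ℕ) : ℝ))⁻¹)) + ((L ^ i.kk : ℕ) : ℝ)⁻¹) *
          Real.exp (-(δS * tdistT M y y')) := hS
    _ ≤ ((C * (2 * Kz + 1) + 1) * t) * Real.exp (-(δS * tdistT M y y')) := mul_le_mul_of_nonneg_right hamp hE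
    _ = _ := by rw [ht_def]; ring

end SiteLayer

end Summit.QuantumFields.YangMills.BalabanUVNodes.N15.SiteLayerSf

end
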